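import Literature.MathematicalPhysics.QuantumFieldTheory.ConformalBootstrap3D.PointKernelK34v2Data

/-!
# K34v2 certificate, kernel block file H16: head segments `242 ≤ i < 258` (block-checked ones)

`decide` by kernel reduction (no `native_decide`, no extra axioms) of the block checker
`PCert.hBlockOK` of `PointKernel` on the literal data of `PointKernelK34v2Data` (cells checked corner
or chord by the rule bit); soundness is `PCert.hBlockOK_sound`.  Estimated kernel time 232 s
(5 theorems).
-/

set_option maxRecDepth 100000
set_option maxHeartbeats 0

namespace Literature.MathematicalPhysics.QuantumFieldTheory.ConformalBootstrap3D.PointKernelK34v2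

open Literature.MathematicalPhysics.QuantumFieldTheory.ConformalBootstrap3D.PointKernel

/-- head segments `[242, 249)` pass the kernel evaluator (≈41 s of kernel work). [folklore] -/
theorem hBlock_242 : certK34v2.hBlockOK hsegsK34v2 242 249 JHK34v2 = true := by
  decide +kernel

/-- head segments `[249, 255)` pass the kernel evaluator (≈2 s of kernel work). [folklore] -/
theorem hBlock_249 : certK34v2.hBlockOK hsegsK34v2 249 255 JHK34v2 = true := by
  decide +kernel

/-- head segment `[255, 256)` passes the kernel evaluator (≈44 s of kernel work). [folklore] -/
theorem hBlock_255 : certK34v2.hBlockOK hsegsK34v2 255 256 JHK34v2 = true := by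
  decide +kernel

/-- head segment `[256, 257)` passes the kernel evaluator (≈44 s of kernel work). [folklore] -/
theorem hBlock_256 : certK34v2.hBlockOK hsegsK34v2 256 257 JHK34v2 = true := by
  decide +kernel

/-- head segment `[257, 258)` passes the kernel evaluator (≈41 s of kernel work). [folklore] -/
theorem hBlock_257 : certK34v2.hBlockOK hsegsK34v2 257 258 JHK34v2 = true := by
  decide +kernel

end Literature.MathematicalPhysics.QuantumFieldTheory.ConformalBootstrap3D.PointKernelK34v2
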